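import Literature.MathematicalPhysics.QuantumFieldTheory.Balaban1983to89.B9Cor36CinvCubeLocLetter
import Literature.MathematicalPhysics.QuantumFieldTheory.Balaban1983to89.B9Eq352DivFormLetters

/-!
# `Balaban1983to89.B9Cor36CinvCubeLocLetterMajorant` — THE (3.48) BLOCK MAJORANT OF THE C-JUNCTION LETTER `C_□ = J·1_N·R_c(u)⁻¹·Ĉ(Ṽ)·R_c(u)·1_N·J⋆`
# ON THE MEMBER's BLOCKS, TRANSFERRED FROM A BLOCK MAJORANT OF `Ĉ(Ṽ)` ON THE CUBE SEQUENCE's BLOCKS — the displayed input `hC` of p21's M5.6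
# defect edition `B9Thm39CinvAtCoverLargeDefect.cinv_cover_large_defect` REDUCED to the cube-side Theorem 3.2 datum (sub-row G-B9-LETTERS, module
# M5.2-E, FILE E2-2; design (β) of `lit-balaban-p21/M52E-DESIGN-p21.md`)

T. Bałaban, *Propagators for lattice gauge theories in a background field*, Commun. Math. Phys. **99** (1985) 389–434
[`Balaban1985BackgroundPropagators`, "B9"]; [4] = T. Bałaban, *Propagators and renormalization transformations for lattice gauge
theories. II*, Commun. Math. Phys. **96** (1984) 223–250 [`Balaban1984PropagatorsII`].

statement-level skeleton of published theorems with citation tags; proofs where landed; nothing here is a claim about the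
Yang–Mills mass gap

THE PRINTED LOCUS (verbatim, held `paper:balaban1985-cmp99-background-propagators`, journal page = PDF page + 388).  p. 409 l. 2–5: *«The operators
constructed for this sequence, which we denote by G′_□(U), C_□(U) = (Q′(U)G′²_□(U)Q′\*(U))⁻¹, … satisfy all the inequalities of Theorems 3.1–3.3
correspondingly»*; Thm 3.2 (3.48) p. 398: *«|(Q′(U)G′²(U)Q′\*(U))⁻¹(y, y′)| ≦ B₀(Lʲη)⁻⁴(L^{j′}η)^{−d}e^{−δ₀d(y,y′)} for y ∈ Λ_j, y′ ∈ Λ_{j′}»*; Cor. 3.6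
p. 408 l. 11–14: *«all the results of these theorems are gauge invariant, so they hold for the configuration U also»*; [4] (2.51)–(2.55) p. 232 (block
majorants, *«this property is preserved under the composition of operators possessing it»*), (2.45)–(2.46) p. 231 (the blocks `𝔅` and their distance).

WHY THIS FILE.  p21's M5.6 defect edition displays, per cover cube, `hC : conj b ((η_S²η_S²)⁻¹ • Cl □) ≺ B₀·ℓ(a)⁻⁴·e^{−bbδ₀d(a,a′)}` over the MEMBER's block
geometry (`toB6 (geo9K i) …`, block map `(t, j) ↦ ιB t`), for the letter `Cl □ = cinvLocLetterY …` of FILE E2-1, which lives on the member's blocks but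
is BUILT from r05's `XinvCubeY i □ parS Ṽ` on the cube sequence's blocks.  The cube-side Theorem 3.2 (Sect. B at the cube, FILE E2-4) delivers a block
majorant of `conj b (c • Ĉ(Ṽ))` over a geometry on the CUBE SEQUENCE's blocks.  THIS FILE is the bookkeeping in between, GENERIC in both geometries:
* §1 ★★ `hasMajorant_conj_bridge_sandwich`: for ANY `ℝ`-linear `M` on the cube sequence's block functions with `conj b M ≺ K_C` over a geometry `g_C`
  (block map `(s, j) ↦ σ s`), ANY target geometry `g_D` with an injective block map `(t, j) ↦ τ t` and kernel `K ≥ 0` dominating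
  `(M₂Σ_j‖b_j‖)²·K_C(σ s, σ s′)` on the twins of the truncation set `N` (common blocks), and a bi-contractive block gauge `γ`:
  `conj b (J·1_N·R(γ)⁻¹·M·R(γ)·1_N·J⋆) ≺ K` — the two factors `M₂Σ‖b_j‖` are the passage `𝔸 ⇄` real coordinates at the two gauge rotations
  ([B9] p. 408 «gauge invariant»; [4] (2.52): a block-diagonal factor scales a majorant).
* §2 ★★ `hasMajorant_conj_smul_cinvLocLetterY`: the same for `c • cinvLocLetterY i □ parS u Ṽ N` from `conj b (c • (XinvCubeY i □ parS Ṽ)|_ℝ) ≺ K_C` — M5.6's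
  `hC` modulo the cube-side (3.48) datum and the comparison of the two geometries on `N` (r05 `B9CubeCoarsening.dist_coarsen_le`: coarsening contracts
  the distance; levels agree on common pairs).

HONEST SCOPE.  Finite bookkeeping of [4] (2.51)-majorants under extension-by-zero, truncation and block-diagonal gauge rotation; NO estimate of [B9] is proved
(the cube-side (3.48) datum `hM`∕`hC` is a HYPOTHESIS — FILE E2-4, blocked on the C-clause carrier repair R-Ker-1 of `B9Thm34SectBUniformR1.thm34_Cinv_uniform`,
INTERFACES-r06 §111 — and so is the geometry comparison `hcmp`).  Inhabited: `N := ∅` makes the letter `0` and the conclusion `0 ≺ K` for every `K ≥ 0`; at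
`g_C := g_D` restricted along the twins with `K := (M₂Σ‖b‖)²K_C` the comparison is equality — not a vacuous schema.  Count-neutral; no summit ∕ sub-problem
statement is proved; nothing continuum ∕ OS ∕ mass-gap ∕ Clay.  No `sorry`, no `axiom`, no `… : Prop` fact, no `instance`, no `notation`, no `def`.  NEW
file; nothing landed is modified.  Cell `lit-balaban`, seat `lit-balaban-p21` gen 34, 2026-08-28; `--supports stmt-QuantumFields-19200` as helper.
Net new unproved facts: 0.

RELATED IN THE TREE, NOT DUPLICATED (searched 2026-08-28): p21 `B9Cor36CinvCubeLocLetter` (FILE E2-1: the letter, the bridge); T9∕p21 `B9Eq352DivFormLetters`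
(`conj`, `coordEquiv`, `norm_coordSymm_apply_le` — the (2.51) reading over real coordinates); pv08 `B6RandomWalk` (`HasMajorant`, `BlockSupp`); ym-ust
`B9Conv348GaugeOrbitAtLettersY.hasMajorant_realify39_conjY` (the diagonal majorant of `R(u)` in M5.2's `realify39` currency — same mechanism, other
reading; not imported); r05 `B9CubeCoarsening.majorant_transfer_of_nearH` (transfer of SCALAR site-operator majorants cube → member for sources near `□` —
the site-sector analogue) — USED BY NAME where stated; no existing module modified.
-/

noncomputable section

namespace Literature.MathematicalPhysics.QuantumFieldTheory.Balaban1983to89.B9Cor36CinvCubeLocLetterMajorant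

open Literature.MathematicalPhysics.QuantumFieldTheory.Balaban1983to89.B9Eq39Adjoint (R R_zero)
open Literature.MathematicalPhysics.QuantumFieldTheory.Balaban1983to89.B6KLevelCensusIndexV1 (KIdx)
open Literature.MathematicalPhysics.QuantumFieldTheory.Balaban1983to89.B6Cover236MultiLevelBlocks (cubes)
open Literature.MathematicalPhysics.QuantumFieldTheory.Balaban1983to89.B6Geom246MultiLevelBox (bset)
open Literature.MathematicalPhysics.QuantumFieldTheory.Balaban1983to89.B6RandomWalk (HasMajorant BlockSupp)
open Literature.MathematicalPhysics.QuantumFieldTheory.Balaban1983to89.B9Eq352DivFormLetters (conj conj_apply coordEquiv coordEquiv_apply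
  coordEquiv_symm_apply norm_coordSymm_apply_le)
open Literature.MathematicalPhysics.QuantumFieldTheory.Balaban1983to89.B9CubeLettersOpsL0 (cubeFamY)
open Literature.MathematicalPhysics.QuantumFieldTheory.Balaban1983to89.B9CubeLettersBondOpsL0 (BlkCubeY XinvCubeY)
open Literature.MathematicalPhysics.QuantumFieldTheory.Balaban1983to89.B9Cor36CinvCubeLocLetter (cubeToBlkY blkToCubeY cubeToBlkY_apply_of_mem
  cubeToBlkY_apply_of_not_mem blkToCubeY_apply_of_mem blkToCubeY_apply_of_not_mem cubeBlkInd cubeBlkInd_apply gBlkCubeY cinvLocLetterY)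
open Literature.MathematicalPhysics.QuantumFieldTheory.Balaban1983to89.B9Thm37CubeCoverCommutators (cutMulY cutMulY_apply)
open Literature.MathematicalPhysics.QuantumFieldTheory.Balaban1983to89.Node00 (SiteY BlkY CfgY SiteParY GaugeY conjY conjY_apply gSiteY toKT)

variable {d ℓ : ℕ} {hd : 1 ≤ d + 1} {hL : Odd (ℓ + 1) ∧ 1 < ℓ + 1} {b₀ b₁ : ℝ}
variable {𝔸 : Type} [NormedRing 𝔸] [NormedAlgebra ℂ 𝔸] [CompleteSpace 𝔸] {ι : Type} [Fintype ι]

/-! ## §1 The bridge–sandwich transfer of a block majorant from the cube sequence's blocks to the member's blocks -/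

section Transfer

variable (i : KIdx d ℓ hd hL b₀ b₁) (q : ↥(cubes (toKT i).D.toDomains)) (b : Module.Basis ι ℝ 𝔸)

omit [CompleteSpace 𝔸] [Fintype ι] in
/-- the coordinate bound of a unit-type conjugation: `|b.repr (R(u)a) j| ≤ M₂‖a‖`. [cite: Balaban1984PropagatorsII, (2.51) p.232; Balaban1985BackgroundPropagators, (3.28) p.395, bookkeeping] -/
theorem abs_repr_R_le {M₂ : ℝ} (hrepr : ∀ (v : 𝔸) (j : ι), |b.repr v j| ≤ M₂ * ‖v‖) (hM₂ : 0 ≤ M₂) {u : 𝔸ˣ} (hu : ∀ a, ‖R u a‖ ≤ ‖a‖)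
    (a : 𝔸) (j : ι) : |b.repr (R u a) j| ≤ M₂ * ‖a‖ :=
  (hrepr _ _).trans (mul_le_mul_of_nonneg_left (hu a) hM₂)

omit [CompleteSpace 𝔸] in
/-- the synthesis bound: `‖v‖ ≤ (Σ_j‖b_j‖)·max_j |b.repr v j|`. [cite: Balaban1984PropagatorsII, (2.51) p.232, bookkeeping] -/
theorem norm_le_sum_mul_of_repr_le (v : 𝔸) {B : ℝ} (h : ∀ j, |b.repr v j| ≤ B) : ‖v‖ ≤ (∑ j, ‖b j‖) * B := by
  have e : (coordEquiv b).symm (coordEquiv b (fun _ : Unit => v)) () = v := by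
    rw [LinearEquiv.symm_apply_apply]
  rw [← e]
  exact norm_coordSymm_apply_le b _ () B fun j => by rw [coordEquiv_apply]; exact h j

omit [CompleteSpace 𝔸] in
/-- ★★ **THE BRIDGE–SANDWICH TRANSFER.**  Let `M` be an `ℝ`-linear operator on the cube sequence's `𝔸`-valued block functions whose coordinate conjugate has the
block majorant `K_C` over a geometry `g_C` with block map `(s, j) ↦ σ s`; let `g_D` be a geometry with an INJECTIVE block map `(t, j) ↦ τ t` on the member's blocks
and `K ≥ 0` a kernel with `(M₂Σ_j‖b_j‖)²·K_C(σ s, σ s′) ≤ K(τ t, τ t′)` whenever `s, s′ ∈ N` are common blocks with member twins `t, t′`; let `γ` be a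
bi-contractive block gauge.  Then `conj b (J·1_N·R(γ)⁻¹·M·R(γ)·1_N·J⋆) ≺ K` over `g_D`.  (A source supported in the block `t′` is moved by `J⋆`, `1_N`, `R(γ)` to a
source supported in the twin cube block `s′` with coordinates `≤ M₂Σ‖b‖·|source|`; `M` maps it under `K_C(·, σ s′)`; `R(γ)⁻¹`, `1_N`, `J` move the result back,
at the cost of one more `M₂Σ‖b‖`, and kill every row that is not a twin of a block of `N`.)
[cite: Balaban1984PropagatorsII, (2.51)–(2.55) p.232, (2.45) p.231; Balaban1985BackgroundPropagators, Thm 3.2 (3.48) p.398, p.409 l.2–5, Cor. 3.6 p.408 l.11–14] -/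
theorem hasMajorant_conj_bridge_sandwich {M₂ : ℝ} (hM₂ : 0 ≤ M₂) (hrepr : ∀ (v : 𝔸) (j : ι), |b.repr v j| ≤ M₂ * ‖v‖)
    (γ : BlkCubeY i q → 𝔸ˣ) (hγ : ∀ s a, ‖R (γ s) a‖ ≤ ‖a‖ ∧ ‖R (γ s)⁻¹ a‖ ≤ ‖a‖)
    (N : Finset (BlkCubeY i q))
    {gC gD : B6.Geometry} (σ : BlkCubeY i q → gC.Site) (τ : BlkY i → gD.Site) (hτ : Function.Injective τ)
    {KC : gC.Site → gC.Site → ℝ} {K : gD.Site → gD.Site → ℝ} (hK : ∀ a a', 0 ≤ K a a')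
    (hcmp : ∀ s ∈ N, ∀ s' ∈ N, ∀ (hs : s.1 ∈ bset i.D.toDomains) (hs' : s'.1 ∈ bset i.D.toDomains),
      (M₂ * ∑ j, ‖b j‖) ^ 2 * KC (σ s) (σ s') ≤ K (τ ⟨s.1, hs⟩) (τ ⟨s'.1, hs'⟩))
    (M : Module.End ℝ (BlkCubeY i q → 𝔸)) (hM : HasMajorant (g := gC) (fun p : BlkCubeY i q × ι => σ p.1) (conj b M) KC) :
    HasMajorant (g := gD) (fun p : BlkY i × ι => τ p.1)
      (conj b ((cubeToBlkY (𝔸 := 𝔸) i q).restrictScalars ℝ ∘ₗ (cutMulY (𝔸 := 𝔸) (cubeBlkInd i q N)).restrictScalars ℝ ∘ₗ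
        (conjY γ⁻¹).restrictScalars ℝ ∘ₗ M ∘ₗ (conjY γ).restrictScalars ℝ ∘ₗ (cutMulY (𝔸 := 𝔸) (cubeBlkInd i q N)).restrictScalars ℝ ∘ₗ
        (blkToCubeY (𝔸 := 𝔸) i q).restrictScalars ℝ)) K := by
  intro y' μ B hμ x
  have hSb : 0 ≤ ∑ j, ‖b j‖ := Finset.sum_nonneg fun _ _ => norm_nonneg _
  have hKB : 0 ≤ K (τ x.1) y' * B := mul_nonneg (hK _ _) hμ.nonneg
  -- the source on the member's blocks
  set lam : BlkY i → 𝔸 := (coordEquiv b).symm μ with hlam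
  -- the source moved to the cube sequence's blocks and rotated
  set ν : BlkCubeY i q → 𝔸 := conjY γ (cutMulY (cubeBlkInd i q N) (blkToCubeY i q lam)) with hν
  rw [conj_apply]
  simp only [LinearMap.comp_apply, LinearMap.restrictScalars_apply]
  rw [← hlam]
  change |b.repr (cubeToBlkY i q (cutMulY (cubeBlkInd i q N) (conjY γ⁻¹ (M ν))) x.1) x.2| ≤ K (τ x.1) y' * B
  -- rows that are not twins of blocks of `N` vanish
  by_cases hx : x.1.1 ∈ B6Geom246MultiLevelBoxL0.bset (cubeFamY i q).toDomains
  swap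
  · rw [cubeToBlkY_apply_of_not_mem i q _ hx, map_zero, Finsupp.zero_apply, abs_zero]; exact hKB
  set s : BlkCubeY i q := ⟨x.1.1, hx⟩ with hs
  rw [cubeToBlkY_apply_of_mem i q _ hx, cutMulY_apply, cubeBlkInd_apply]
  by_cases hsN : s ∈ N
  swap
  · rw [← hs, if_neg hsN, Complex.ofReal_zero, zero_smul, map_zero, Finsupp.zero_apply, abs_zero]; exact hKB
  rw [← hs, if_pos hsN, Complex.ofReal_one, one_smul, conjY_apply]
  -- `|b.repr (R(γ s)⁻¹ a) j| ≤ M₂‖a‖`, `a = (Mν)(s)`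
  refine (abs_repr_R_le b hrepr hM₂ (fun a => (hγ s a).2) _ _).trans ?_
  -- the support block `t′` of the source (if any)
  by_cases hy : ∃ t' : BlkY i, τ t' = y'
  swap
  · -- no member block over `y′`: the source vanishes
    have hμ0 : μ = 0 := funext fun p => hμ.off p fun h => hy ⟨p.1, h⟩
    have hlam0 : lam = 0 := by rw [hlam, hμ0, map_zero]
    have hν0 : ν = 0 := by rw [hν, hlam0, map_zero, map_zero, map_zero]
    rw [hν0, map_zero, Pi.zero_apply, norm_zero, mul_zero]; exact hKB
  obtain ⟨t', ht'⟩ := hy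
  -- the source is supported in `t′` and bounded there by `(Σ‖b‖)·B`
  have hlam_off : ∀ t'', t'' ≠ t' → lam t'' = 0 := fun t'' ht'' => by
    rw [hlam, coordEquiv_symm_apply]
    refine Finset.sum_eq_zero fun j _ => ?_
    rw [hμ.off (t'', j) (fun h => ht'' (hτ (h.trans ht'.symm))), zero_smul]
  have hlam_bd : ‖lam t'‖ ≤ (∑ j, ‖b j‖) * B := by
    rw [hlam]
    exact norm_coordSymm_apply_le b μ t' B fun j => hμ.bound (t', j) ht'
  -- `ν` is supported in the twin `s′` of `t′` (when it exists and lies in `N`) and bounded by `(Σ‖b‖)·B`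
  have hν_val : ∀ s'', ν s'' = R (γ s'') (((cubeBlkInd i q N s'' : ℝ) : ℂ) • blkToCubeY i q lam s'') := fun s'' => by
    rw [hν, conjY_apply, cutMulY_apply]
  have hν_off : ∀ s'', s''.1 ≠ t'.1 → ν s'' = 0 := fun s'' hs'' => by
    rw [hν_val]
    by_cases hmem : s''.1 ∈ bset i.D.toDomains
    · rw [blkToCubeY_apply_of_mem i q _ hmem, hlam_off _ (fun h => hs'' (congrArg Subtype.val h)), smul_zero, R_zero]
    · rw [blkToCubeY_apply_of_not_mem i q _ hmem, smul_zero, R_zero]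
  have hν_offN : ∀ s'', s'' ∉ N → ν s'' = 0 := fun s'' hs'' => by
    rw [hν_val, cubeBlkInd_apply, if_neg hs'', Complex.ofReal_zero, zero_smul, R_zero]
  have hν_bd : ∀ s'', ‖ν s''‖ ≤ (∑ j, ‖b j‖) * B := fun s'' => by
    by_cases h1 : s''.1 = t'.1
    · by_cases h2 : s'' ∈ N
      · have hmem : s''.1 ∈ bset i.D.toDomains := h1 ▸ t'.2
        have ht : (⟨s''.1, hmem⟩ : BlkY i) = t' := Subtype.ext h1
        rw [hν_val, cubeBlkInd_apply, if_pos h2, Complex.ofReal_one, one_smul, blkToCubeY_apply_of_mem i q _ hmem, ht]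
        exact ((hγ s'' _).1).trans hlam_bd
      · rw [hν_offN s'' h2, norm_zero]; exact mul_nonneg hSb hμ.nonneg
    · rw [hν_off s'' h1, norm_zero]; exact mul_nonneg hSb hμ.nonneg
  -- either `ν = 0`, or `t′` has a twin `s′ ∈ N`
  by_cases htw : ∃ s' ∈ N, s'.1 = t'.1
  swap
  · have hν0 : ν = 0 := funext fun s'' => by
      by_cases h2 : s'' ∈ N
      · exact hν_off s'' fun h => htw ⟨s'', h2, h⟩
      · exact hν_offN s'' h2
    rw [hν0, map_zero, Pi.zero_apply, norm_zero, mul_zero]; exact hKB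
  obtain ⟨s', hs'N, hs't'⟩ := htw
  -- the coordinates of `ν`: a source over `g_C` supported in the block `σ s′`, bounded by `M₂(Σ‖b‖)B`
  have hsupp : BlockSupp (g := gC) (fun p : BlkCubeY i q × ι => σ p.1) (coordEquiv b ν) (σ s') (M₂ * ((∑ j, ‖b j‖) * B)) := by
    refine ⟨mul_nonneg hM₂ (mul_nonneg hSb hμ.nonneg), fun p _ => ?_, fun p hp => ?_⟩
    · rw [coordEquiv_apply]
      exact (hrepr _ _).trans (mul_le_mul_of_nonneg_left (hν_bd p.1) hM₂)
    · rw [coordEquiv_apply]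
      have hp' : p.1 ≠ s' := fun h => hp (by rw [h])
      have : ν p.1 = 0 := by
        by_cases h2 : p.1 ∈ N
        · refine hν_off p.1 fun h => hp' (Subtype.ext (h.trans hs't'.symm))
        · exact hν_offN p.1 h2
      rw [this, map_zero, Finsupp.zero_apply]
  -- the cube-side majorant on that source, read at the rows `(s, j′)`
  have hrow : ∀ j', |b.repr (M ν s) j'| ≤ KC (σ s) (σ s') * (M₂ * ((∑ j, ‖b j‖) * B)) := fun j' => by
    have h := hM (σ s') (coordEquiv b ν) _ hsupp (s, j')
    rwa [conj_apply, LinearEquiv.symm_apply_apply] at h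
  have hnorm : ‖M ν s‖ ≤ (∑ j, ‖b j‖) * (KC (σ s) (σ s') * (M₂ * ((∑ j, ‖b j‖) * B))) :=
    norm_le_sum_mul_of_repr_le b _ hrow
  -- comparison of the two geometries on the twins `s ↔ x.1`, `s′ ↔ t′`
  have hs1 : s.1 ∈ bset i.D.toDomains := x.1.2
  have hs'1 : s'.1 ∈ bset i.D.toDomains := hs't' ▸ t'.2
  have hx1 : (⟨s.1, hs1⟩ : BlkY i) = x.1 := Subtype.ext rfl
  have ht'1 : (⟨s'.1, hs'1⟩ : BlkY i) = t' := Subtype.ext hs't'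
  have hc := hcmp s hsN s' hs'N hs1 hs'1
  rw [hx1, ht'1, ht'] at hc
  calc M₂ * ‖M ν s‖ ≤ M₂ * ((∑ j, ‖b j‖) * (KC (σ s) (σ s') * (M₂ * ((∑ j, ‖b j‖) * B)))) := mul_le_mul_of_nonneg_left hnorm hM₂
    _ = (M₂ * ∑ j, ‖b j‖) ^ 2 * KC (σ s) (σ s') * B := by ring
    _ ≤ K (τ x.1) y' * B := mul_le_mul_of_nonneg_right hc hμ.nonneg

end Transfer

/-! ## §2 At the C-junction letter: M5.6's `hC` from the cube-side (3.48) datum -/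

section AtLetter

variable (i : KIdx d ℓ hd hL b₀ b₁) (q : ↥(cubes (toKT i).D.toDomains)) (parS : SiteParY 𝔸 i) (b : Module.Basis ι ℝ 𝔸)

/-- the scaled letter is the bridge–sandwich of the scaled cube inverse (real scalars pass through the `ℂ`-linear bridge, truncation and rotations).
[cite: Balaban1985BackgroundPropagators, p.409 l.2–5, bookkeeping] -/
theorem smul_cinvLocLetterY_restrictScalars (g : GaugeY 𝔸 i) (V : CfgY 𝔸 i) (N : Finset (BlkCubeY i q)) (c : ℝ) :
    c • (cinvLocLetterY i q parS g V N).restrictScalars ℝ =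
      (cubeToBlkY (𝔸 := 𝔸) i q).restrictScalars ℝ ∘ₗ (cutMulY (𝔸 := 𝔸) (cubeBlkInd i q N)).restrictScalars ℝ ∘ₗ
        (conjY (gBlkCubeY i q g)⁻¹).restrictScalars ℝ ∘ₗ (c • (XinvCubeY i q parS V).restrictScalars ℝ) ∘ₗ
        (conjY (gBlkCubeY i q g)).restrictScalars ℝ ∘ₗ (cutMulY (𝔸 := 𝔸) (cubeBlkInd i q N)).restrictScalars ℝ ∘ₗ
        (blkToCubeY (𝔸 := 𝔸) i q).restrictScalars ℝ := by
  refine LinearMap.ext fun v => ?_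
  simp only [LinearMap.smul_apply, LinearMap.restrictScalars_apply, cinvLocLetterY, LinearMap.comp_apply, LinearMap.map_smul_of_tower]

/-- ★★ **M5.6's `hC` FROM THE CUBE-SIDE (3.48) DATUM**: if `conj b (c • Ĉ(Ṽ)) ≺ K_C` over a geometry `g_C` on the cube sequence's blocks (Theorem 3.2 for the sequence
`{Ω_n(□)}` at the localised field — FILE E2-4), the block gauge `u` is bi-contractive, and `K ≥ 0` dominates `(M₂Σ‖b‖)²K_C` on the twins of `N` under an injective
member block map `τ` (M5.6: `τ = ιB`, `K(a,a′) = B₀ℓ(a)⁻⁴e^{−bbδ₀d(a,a′)}`), then `conj b (c • C_□) ≺ K` over the member's geometry.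
[cite: Balaban1985BackgroundPropagators, Thm 3.2 (3.48) p.398, p.409 l.2–5, Cor. 3.6 p.408 l.11–14, (3.95) p.411; Balaban1984PropagatorsII, (2.51)–(2.55) p.232] -/
theorem hasMajorant_conj_smul_cinvLocLetterY {M₂ : ℝ} (hM₂ : 0 ≤ M₂) (hrepr : ∀ (v : 𝔸) (j : ι), |b.repr v j| ≤ M₂ * ‖v‖)
    (g : GaugeY 𝔸 i) (hg : ∀ z a, ‖R (gSiteY i g z) a‖ ≤ ‖a‖ ∧ ‖R (gSiteY i g z)⁻¹ a‖ ≤ ‖a‖) (V : CfgY 𝔸 i)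
    (N : Finset (BlkCubeY i q))
    {gC gD : B6.Geometry} (σ : BlkCubeY i q → gC.Site) (τ : BlkY i → gD.Site) (hτ : Function.Injective τ)
    {KC : gC.Site → gC.Site → ℝ} {K : gD.Site → gD.Site → ℝ} (hK : ∀ a a', 0 ≤ K a a')
    (hcmp : ∀ s ∈ N, ∀ s' ∈ N, ∀ (hs : s.1 ∈ bset i.D.toDomains) (hs' : s'.1 ∈ bset i.D.toDomains),
      (M₂ * ∑ j, ‖b j‖) ^ 2 * KC (σ s) (σ s') ≤ K (τ ⟨s.1, hs⟩) (τ ⟨s'.1, hs'⟩))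
    (c : ℝ) (hC : HasMajorant (g := gC) (fun p : BlkCubeY i q × ι => σ p.1) (conj b (c • (XinvCubeY i q parS V).restrictScalars ℝ)) KC) :
    HasMajorant (g := gD) (fun p : BlkY i × ι => τ p.1) (conj b (c • (cinvLocLetterY i q parS g V N).restrictScalars ℝ)) K := by
  rw [smul_cinvLocLetterY_restrictScalars]
  exact hasMajorant_conj_bridge_sandwich i q b hM₂ hrepr (gBlkCubeY i q g) (fun s a => hg _ a) N σ τ hτ hK hcmp _ hC

end AtLetter

end Literature.MathematicalPhysics.QuantumFieldTheory.Balaban1983to89.B9Cor36CinvCubeLocLetterMajorant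

end
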